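/-
Copyright (c) 2026 the pub-hodgecm-mathlib formalisation cell (harness21).  Prover seat hodgecm-mathlib-K2E3-p06 (g2), Track B «K2-LIT» ∕ h413,
ENGINE E3 unit U4 «Keys», SIGS-TABLE row #6 `sig_K2E3IrregularReducibleCaseThree` — analytic letter hKP, brick F5a (bookkeeping for the test functions of Tate's trick).
-/
import Summits.HodgeConjecture.HodgeConjecture.Theorems.K2E3DualZetaEvaluation        -- ★ brick F4c (this seat); brings ★ F2 ∕ F3 ∕ F4 ∕ F4b
import Literature.NumberTheory.Automorphic.TateGaussSums                              -- ★ `TateDirect.extend_*` (the character extended by zero), `one_add_mem_unitFiltration`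
import Literature.NumberTheory.Automorphic.TateLocalSchwartzBruhat                    -- ★ `SchwartzBruhat`, `indicator_*_mem_schwartzBruhat`
import HarnessLib

/-!
# K2 · E3 · U4 «Keys», row #6 — brick F5a: bookkeeping for Keys' Plancherel non-vanishing — the unitary character `χ̃` extended by zero, and the truncated two-bump
# test function `g_T(x) = Φ(Re x)𝟙[‖Im x‖ ≤ T]` is Schwartz–Bruhat and vanishes near `0` [Tate1950 §2.3–2.5; Keys1984 §5]

Cell `pub/hodgecm-mathlib` (D-0151), HCML Track B «K2-LIT», crux H413 = `stmt-HodgeConjecture-24833` (lane `--supports … --as helper`), route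
HCCMUnconditional; socket `sig_K2E3IrregularReducibleCaseThree` (U4-c) of `Cruxes/H413/Lines/K2_E3_EllipticInputsSigs_U4Keys.lean`.
THEOREMS ONLY (0 def ∕ 0 instance ∕ 0 notation ∕ 0 sorry); ★-only imports.  FRAME of ★ bricks F2–F4c.
* §1 `hasExponent_zero_of_conj_mul` (`χ(σu·u) = 1`, `σ` isometric ⇒ `χ` unitary), `extend_mul_all`, `norm_extend_le_one`, `extend_one_add_eq_one` (`χ̃(1+t) = 1` for `‖t‖ ≤ q^{−M}`,
  `χ|_{U^M} = 1`), `extend_inv_apply_eq_neg_one` (`χ̄(c₀) = −1` at a fixed unit with `χ(c₀) ≠ 1`);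
* §2 the two-bump `Φ(a) = ψ(−a)𝟙_B(a) − ψ(−c₀a)𝟙_B(c₀a)` (`B = {‖·‖ ≤ ρ}`): `isOpen_setOf_normAbs_le`, `measurable_twoBump`, `norm_twoBump_le`, `twoBump_eq_zero_of_normAbs_le`
  (`Φ = 0` near `0`), `twoBump_eq_zero_of_lt_normAbs` (`Φ = 0` off `{‖a‖ ≤ max(ρ, ρ/‖c₀‖)}`), `isLocallyConstant_twoBump`;
* §3 `truncTest_mem_schwartzBruhat` (`x ↦ Φ(½(x+σx))𝟙[‖½(x−σx)‖ ≤ T] ∈ 𝒮(E)` for `Φ` locally constant vanishing off a ball), `truncTest_eq_zero_of_normAbs_le`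
  (it vanishes on a ball around `0` when `Φ` does: `‖Re x‖ ≤ ‖½‖‖x‖`).
HONEST LABEL: HC_CM is proved only modulo the 7 printed citations (2 remaining named inputs: hLiu418 = `stmt-HodgeConjecture-24832`, h413 =
`stmt-HodgeConjecture-24833`) until rung 0 closes; count-neutral analytic plumbing (no socket paid here).

## References
* [Tate1950] J. Tate, *Fourier analysis in number fields and Hecke's zeta-functions* (1950), §2.2 (Schwartz–Bruhat functions), §2.3 (quasi-characters), §2.5.
* [Keys1984] D. Keys, *Principal series representations of special unitary groups over local fields*, Compositio Math. 51 (1984), §5.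
* [Rogawski1990] J. D. Rogawski, *Automorphic Representations of Unitary Groups in Three Variables*, Ann. of Math. Stud. 123 (1990), §12.2 p. 173.
-/

set_option autoImplicit false
-- the mandated namespace has the single-problem summit's repeated segment (`HodgeConjecture.HodgeConjecture`)
set_option linter.dupNamespace false

noncomputable section

open scoped NNReal ENNReal Topology Pointwise
open MeasureTheory Filter Set
open Literature.NumberTheory.GaloisRepresentations.IsNonarchimedeanLocalField
open Literature.NumberTheory.Automorphic
open Literature.NumberTheory.Automorphic.TateDirect
open Literature.NumberTheory.Automorphic.UnitaryGroup.HeisRing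
open Summit.HodgeConjecture.HodgeConjecture.Cruxes.H413.K2E3SkewLineIntegrable
open Summit.HodgeConjecture.HodgeConjecture.Cruxes.H413.K2E3SkewLineZetaFibration
open Summit.HodgeConjecture.HodgeConjecture.Cruxes.H413.K2E3SigmaEvenCharacter

namespace Summit.HodgeConjecture.HodgeConjecture.Cruxes.H413.K2E3KeysSkewLineTestFunctions

variable {E : Type*} [Field E] [ValuativeRel E] [TopologicalSpace E] [IsNonarchimedeanLocalField E]
  (σ : E →+* E) (hσ : ∀ x, σ (σ x) = x) (hσc : Continuous σ) [Invertible (2 : E)]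
  (hσn : ∀ x, normAbs E (σ x) = normAbs E x)

/-! ## §1 The unitary character extended by zero -/

section Bookkeeping

omit [Invertible (2 : E)] in
include hσn in
/-- **`χ` is unitary**: `|χ(σu)| |χ(u)| = 1` with `|χ| = ‖·‖^s` (★ `QuasiChar.exists_hasExponent`) and `‖σu‖ = ‖u‖` give `(‖u‖^s)² = 1`, so `|χ(u)| = 1 = ‖u‖^0`.
[cite: Rogawski1990, §12.2 p. 173] [cite: Tate1950, §2.3] -/
theorem hasExponent_zero_of_conj_mul (χ : QuasiChar E) (hχσ : ∀ u : Eˣ, χ (Units.map (σ : E →* E) u) * χ u = 1) : χ.HasExponent 0 := by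
  obtain ⟨s, hs⟩ := QuasiChar.exists_hasExponent χ
  intro u
  have hσu : normAbs E ((Units.map (σ : E →* E) u : Eˣ) : E) = normAbs E (u : E) := hσn u
  have h1 : ‖((χ (Units.map (σ : E →* E) u) : ℂˣ) : ℂ)‖ * ‖((χ u : ℂˣ) : ℂ)‖ = 1 := by
    rw [← norm_mul, ← Units.val_mul, hχσ u, Units.val_one, norm_one]
  rw [hs, hs, hσu] at h1
  have hpos : 0 < ((normAbs E (u : E) : ℝ≥0) : ℝ) ^ s := Real.rpow_pos_of_pos (by exact_mod_cast normAbs_units_pos u) s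
  have hx : ((normAbs E (u : E) : ℝ≥0) : ℝ) ^ s = 1 := by
    rcases mul_self_eq_one_iff.1 h1 with h | h
    · exact h
    · linarith
  rw [hs, hx, Real.rpow_zero]

omit [ValuativeRel E] [IsNonarchimedeanLocalField E] [Invertible (2 : E)] in
/-- `χ̃(a b) = χ̃(a) χ̃(b)` for the extension by zero (all `a, b`). [cite: Tate1950, §2.3] -/
theorem extend_mul_all (χ : QuasiChar E) (a b : E) :
    Function.extend ((↑) : Eˣ → E) (fun u => ((χ u : ℂˣ) : ℂ)) 0 (a * b) =
      Function.extend ((↑) : Eˣ → E) (fun u => ((χ u : ℂˣ) : ℂ)) 0 a * Function.extend ((↑) : Eˣ → E) (fun u => ((χ u : ℂˣ) : ℂ)) 0 b := by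
  by_cases ha : a = 0
  · rw [ha, zero_mul, extend_apply_zero, zero_mul]
  by_cases hb : b = 0
  · rw [hb, mul_zero, extend_apply_zero, mul_zero]
  exact extend_mul χ ha hb

omit [Invertible (2 : E)] in
/-- `‖χ̃(b)‖ ≤ 1` for a unitary `χ`. [cite: Tate1950, §2.3] -/
theorem norm_extend_le_one (χ : QuasiChar E) (hχ : χ.HasExponent 0) (b : E) :
    ‖Function.extend ((↑) : Eˣ → E) (fun u => ((χ u : ℂˣ) : ℂ)) 0 b‖ ≤ 1 := by
  by_cases hb : b = 0
  · rw [hb, extend_apply_zero, norm_zero]; exact zero_le_one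
  · rw [norm_extend χ hχ hb, Real.rpow_zero]

omit [Invertible (2 : E)] in
/-- **`χ̃(1 + t) = 1` for `‖t‖ ≤ q^{-M}`** when `χ` is trivial on `U^M` (`M ≥ 1`; ★ `one_add_mem_unitFiltration`). [cite: Tate1950, §2.3] -/
theorem extend_one_add_eq_one (χ : QuasiChar E) {M : ℕ} (hM : 1 ≤ M) (hχM : ∀ x ∈ unitFiltration E M, χ x = 1)
    (t : E) (ht : normAbs E t ≤ ((residueFieldCard E : ℝ≥0)⁻¹) ^ (M : ℤ)) :
    Function.extend ((↑) : Eˣ → E) (fun u => ((χ u : ℂˣ) : ℂ)) 0 (1 + t) = 1 := by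
  have ht' : t ∈ primePowBall E M := ht
  have h0 := one_add_ne_zero hM ht'
  rw [extend_apply_of_ne_zero χ h0, hχM _ (one_add_mem_unitFiltration hM ht' h0), Units.val_one]

omit [ValuativeRel E] [IsNonarchimedeanLocalField E] [Invertible (2 : E)] in
/-- **`χ̄(c₀) = −1`** for the inverse character at a `σ`-fixed unit `c₀` with `χ(c₀) ≠ 1`: `χ(σc₀)χ(c₀) = χ(c₀)² = 1`. [cite: Rogawski1990, §12.2 p. 173] -/
theorem extend_inv_apply_eq_neg_one (χ : QuasiChar E) (hχσ : ∀ u : Eˣ, χ (Units.map (σ : E →* E) u) * χ u = 1)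
    (c₀ : Eˣ) (hc₀ : σ (c₀ : E) = c₀) (hχc₀ : χ c₀ ≠ 1) :
    Function.extend ((↑) : Eˣ → E) (fun u => ((χ⁻¹ u : ℂˣ) : ℂ)) 0 (c₀ : E) = -1 := by
  have hfix : Units.map (σ : E →* E) c₀ = c₀ := Units.ext hc₀
  have hsq : ((χ c₀ : ℂˣ) : ℂ) * ((χ c₀ : ℂˣ) : ℂ) = 1 := by
    have h := congrArg (fun u : ℂˣ => (u : ℂ)) (hχσ c₀)
    simp only [hfix, Units.val_mul, Units.val_one] at h
    exact h
  have hne : ((χ c₀ : ℂˣ) : ℂ) ≠ 1 := fun h => hχc₀ (Units.val_eq_one.1 h)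
  have hval : ((χ c₀ : ℂˣ) : ℂ) = -1 := (mul_self_eq_one_iff.1 hsq).resolve_left hne
  rw [extend_apply_coe]
  change (((χ c₀)⁻¹ : ℂˣ) : ℂ) = -1
  rw [Units.val_inv_eq_inv_val, hval, inv_neg, inv_one]

end Bookkeeping

/-! ## §2 The two-bump profile `Φ` on `E` -/

section TwoBump

variable (ψ : AddChar E Circle)

omit [Invertible (2 : E)] in
/-- Closed balls `{‖x‖ ≤ ρ}` with `ρ > 0` are OPEN (ultrametric: `y + {‖h‖ < ρ} ⊆ {‖·‖ ≤ ρ}` for `‖y‖ ≤ ρ`). [cite: WeilBNT1967, Ch. I §2] -/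
theorem isOpen_setOf_normAbs_le {ρ : ℝ≥0} (hρ : 0 < ρ) : IsOpen {x : E | normAbs E x ≤ ρ} := by
  rw [isOpen_iff_mem_nhds]
  intro y hy
  have hopen : IsOpen {z : E | normAbs E (z - y) < ρ} := isOpen_lt (LocalFieldHaar.continuous_normAbs.comp (continuous_id.sub continuous_const)) continuous_const
  refine Filter.mem_of_superset (hopen.mem_nhds (by show normAbs E (y - y) < ρ; rw [sub_self, map_zero]; exact hρ)) fun z hz => ?_
  show normAbs E z ≤ ρ
  have : z = y + (z - y) := by ring
  rw [this]
  exact (normAbs_add_le_max _ _).trans (max_le hy (le_of_lt hz))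

variable [MeasurableSpace E] [BorelSpace E]

omit [Invertible (2 : E)] in
/-- The two-bump profile is measurable (for `ψ` continuous). [cite: Tate1950, §2.5] -/
theorem measurable_twoBump (hψc : Continuous ψ) (ρ : ℝ≥0) (c₀ : E) :
    Measurable (fun a : E => ((ψ (-a) : Circle) : ℂ) * {x : E | normAbs E x ≤ ρ}.indicator (fun _ => (1 : ℂ)) a -
      ((ψ (-(c₀ * a)) : Circle) : ℂ) * {x : E | normAbs E x ≤ ρ}.indicator (fun _ => (1 : ℂ)) (c₀ * a)) := by
  have hB : MeasurableSet {x : E | normAbs E x ≤ ρ} := measurableSet_le LocalFieldHaar.continuous_normAbs.measurable measurable_const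
  have h1 : Measurable fun a : E => ((ψ (-a) : Circle) : ℂ) := (continuous_subtype_val.comp (hψc.comp continuous_neg)).measurable
  have h2 : Measurable fun a : E => ((ψ (-(c₀ * a)) : Circle) : ℂ) :=
    (continuous_subtype_val.comp (hψc.comp ((continuous_const.mul continuous_id).neg))).measurable
  exact (h1.mul (measurable_const.indicator hB)).sub (h2.mul ((measurable_const.indicator hB).comp (continuous_const.mul continuous_id).measurable))

omit [Invertible (2 : E)] [MeasurableSpace E] [BorelSpace E] in
/-- `‖Φ a‖ ≤ 2`. [cite: Tate1950, §2.5] -/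
theorem norm_twoBump_le (ρ : ℝ≥0) (c₀ : E) (a : E) :
    ‖((ψ (-a) : Circle) : ℂ) * {x : E | normAbs E x ≤ ρ}.indicator (fun _ => (1 : ℂ)) a -
      ((ψ (-(c₀ * a)) : Circle) : ℂ) * {x : E | normAbs E x ≤ ρ}.indicator (fun _ => (1 : ℂ)) (c₀ * a)‖ ≤ 2 := by
  have hind : ∀ b : E, ‖{x : E | normAbs E x ≤ ρ}.indicator (fun _ => (1 : ℂ)) b‖ ≤ 1 := by
    intro b
    by_cases hb : b ∈ {x : E | normAbs E x ≤ ρ}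
    · rw [Set.indicator_of_mem hb, norm_one]
    · rw [Set.indicator_of_notMem hb, norm_zero]; exact zero_le_one
  refine (norm_sub_le _ _).trans ?_
  rw [norm_mul, norm_mul, Circle.norm_coe, Circle.norm_coe, one_mul, one_mul]
  linarith [hind a, hind (c₀ * a)]

omit [Invertible (2 : E)] [MeasurableSpace E] [BorelSpace E] in
/-- **`Φ = 0` near `0`**: if `‖a‖ ≤ r_ψ`, `‖c₀ a‖ ≤ r_ψ` (so both characters are `1`) and `‖a‖ ≤ ρ`, `‖c₀ a‖ ≤ ρ`, then `Φ(a) = 1 − 1 = 0`. [cite: Tate1950, §2.5] -/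
theorem twoBump_eq_zero_of_normAbs_le {rψ : ℝ≥0} (hrψ : ∀ z : E, normAbs E z ≤ rψ → ψ z = 1) (ρ : ℝ≥0) (c₀ : E) {a : E}
    (h1 : normAbs E a ≤ rψ) (h2 : normAbs E (c₀ * a) ≤ rψ) (h3 : normAbs E a ≤ ρ) (h4 : normAbs E (c₀ * a) ≤ ρ) :
    ((ψ (-a) : Circle) : ℂ) * {x : E | normAbs E x ≤ ρ}.indicator (fun _ => (1 : ℂ)) a -
      ((ψ (-(c₀ * a)) : Circle) : ℂ) * {x : E | normAbs E x ≤ ρ}.indicator (fun _ => (1 : ℂ)) (c₀ * a) = 0 := by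
  rw [hrψ (-a) (by rwa [normAbs_neg]), hrψ (-(c₀ * a)) (by rwa [normAbs_neg]),
    Set.indicator_of_mem (show a ∈ {x : E | normAbs E x ≤ ρ} from h3), Set.indicator_of_mem (show c₀ * a ∈ {x : E | normAbs E x ≤ ρ} from h4), sub_self]

omit [Invertible (2 : E)] [MeasurableSpace E] [BorelSpace E] in
/-- **`Φ = 0` far out**: if `max(ρ, ρ/‖c₀‖) < ‖a‖` (`c₀ ≠ 0`) then `a, c₀ a ∉ B` and `Φ(a) = 0`. [cite: Tate1950, §2.5] -/
theorem twoBump_eq_zero_of_lt_normAbs (ρ : ℝ≥0) {c₀ : E} (hc₀ : c₀ ≠ 0) {a : E} (ha : max ρ (ρ / normAbs E c₀) < normAbs E a) :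
    ((ψ (-a) : Circle) : ℂ) * {x : E | normAbs E x ≤ ρ}.indicator (fun _ => (1 : ℂ)) a -
      ((ψ (-(c₀ * a)) : Circle) : ℂ) * {x : E | normAbs E x ≤ ρ}.indicator (fun _ => (1 : ℂ)) (c₀ * a) = 0 := by
  have hnc₀ : 0 < normAbs E c₀ := pos_iff_ne_zero.2 ((map_ne_zero _).2 hc₀)
  have h1 : a ∉ {x : E | normAbs E x ≤ ρ} := fun h => absurd (lt_of_le_of_lt (le_max_left _ _) ha) (not_lt.2 h)
  have h2 : c₀ * a ∉ {x : E | normAbs E x ≤ ρ} := by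
    intro h
    have h' : normAbs E c₀ * normAbs E a ≤ ρ := by rw [← map_mul]; exact h
    have : normAbs E a ≤ ρ / normAbs E c₀ := by rw [le_div_iff₀ hnc₀, mul_comm]; exact h'
    exact absurd (lt_of_le_of_lt (le_max_right _ _) ha) (not_lt.2 this)
  rw [Set.indicator_of_notMem h1, Set.indicator_of_notMem h2, mul_zero, mul_zero, sub_self]

omit [Invertible (2 : E)] [MeasurableSpace E] [BorelSpace E] in
/-- **`Φ` is locally constant** (`ψ` locally constant, `B` clopen). [cite: Tate1950, §2.2] -/
theorem isLocallyConstant_twoBump (hψ : ψ.IsContinuousNontrivial) {ρ : ℝ≥0} (hρ : 0 < ρ) (c₀ : E) :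
    IsLocallyConstant (fun a : E => ((ψ (-a) : Circle) : ℂ) * {x : E | normAbs E x ≤ ρ}.indicator (fun _ => (1 : ℂ)) a -
      ((ψ (-(c₀ * a)) : Circle) : ℂ) * {x : E | normAbs E x ≤ ρ}.indicator (fun _ => (1 : ℂ)) (c₀ * a)) := by
  obtain ⟨m, hm⟩ := hψ.exists_hasConductorExp
  have hψl : IsLocallyConstant fun y : E => ((ψ y : Circle) : ℂ) := by
    rw [IsLocallyConstant.iff_exists_open]
    intro y
    refine ⟨y +ᵥ primePowBall E m, (isOpen_primePowBall m).vadd _, Set.mem_vadd_set.2 ⟨0, zero_mem_primePowBall _, by simp⟩, ?_⟩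
    rintro y' ⟨k, hk, rfl⟩
    dsimp only
    rw [vadd_eq_add, AddChar.map_add_eq_mul, hm.1 k hk, mul_one]
  have h1 : IsLocallyConstant fun a : E => ((ψ (-a) : Circle) : ℂ) := hψl.comp_continuous continuous_neg
  have h2 : IsLocallyConstant fun a : E => ((ψ (-(c₀ * a)) : Circle) : ℂ) := hψl.comp_continuous ((continuous_const.mul continuous_id).neg)
  have hB : IsLocallyConstant ({x : E | normAbs E x ≤ ρ}.indicator fun _ => (1 : ℂ)) :=
    ((mem_schwartzBruhat_iff).1 (indicator_const_mem_schwartzBruhat (isOpen_setOf_normAbs_le hρ)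
      (isClosed_le LocalFieldHaar.continuous_normAbs continuous_const) (isCompact_setOf_normAbs_le ρ) (1 : ℂ))).1
  have hB2 : IsLocallyConstant fun a : E => {x : E | normAbs E x ≤ ρ}.indicator (fun _ => (1 : ℂ)) (c₀ * a) := hB.comp_continuous (continuous_const.mul continuous_id)
  exact (h1.comp₂ hB (· * ·)).comp₂ (h2.comp₂ hB2 (· * ·)) (· - ·)

end TwoBump

/-! ## §3 The truncated test function `x ↦ Φ(Re x) 𝟙[‖Im x‖ ≤ T]` -/

section TruncTest

include hσc in
/-- **`g_T ∈ 𝒮(E)`**: for `Φ` locally constant vanishing off `{‖a‖ ≤ R}` and `T > 0`, `x ↦ Φ(½(x+σx)) 𝟙[‖½(x−σx)‖ ≤ T]` is locally constant with support in the compact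
`{‖x‖ ≤ max(R, T)}` (`x = Re x + Im x`, ultrametric). [cite: Tate1950, §2.2] -/
theorem truncTest_mem_schwartzBruhat (Φ : E → ℂ) (hΦl : IsLocallyConstant Φ) {R : ℝ≥0} (hΦR : ∀ a, R < normAbs E a → Φ a = 0)
    {T : ℝ≥0} (hT : 0 < T) :
    (fun x => Φ (⅟(2 : E) * (x + σ x)) * {y : E | normAbs E y ≤ T}.indicator (fun _ => (1 : ℂ)) (⅟(2 : E) * (x - σ x))) ∈ SchwartzBruhat E := by
  haveI : T2Space E := (Literature.NumberTheory.GaloisRepresentations.IsNonarchimedeanLocalField.isLocalField E).toT2Space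
  have h2 : (⅟(2 : E)) * 2 = 1 := invOf_mul_self _
  rw [mem_schwartzBruhat_iff]
  constructor
  · have hre : Continuous fun x : E => ⅟(2 : E) * (x + σ x) := continuous_const.mul (continuous_id.add hσc)
    have him : Continuous fun x : E => ⅟(2 : E) * (x - σ x) := continuous_const.mul (continuous_id.sub hσc)
    have hB : IsLocallyConstant ({y : E | normAbs E y ≤ T}.indicator fun _ => (1 : ℂ)) :=
      ((mem_schwartzBruhat_iff).1 (indicator_const_mem_schwartzBruhat (isOpen_setOf_normAbs_le hT)
        (isClosed_le LocalFieldHaar.continuous_normAbs continuous_const) (isCompact_setOf_normAbs_le T) (1 : ℂ))).1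
    exact (hΦl.comp_continuous hre).comp₂ (hB.comp_continuous him) (· * ·)
  · refine HasCompactSupport.intro' (isCompact_setOf_normAbs_le (max R T)) (isClosed_le LocalFieldHaar.continuous_normAbs continuous_const) fun x hx => ?_
    have hx' : max R T < normAbs E x := lt_of_not_ge hx
    have hdec : x = ⅟(2 : E) * (x + σ x) + ⅟(2 : E) * (x - σ x) := by linear_combination (-x) * h2
    by_cases hR : R < normAbs E (⅟(2 : E) * (x + σ x))
    · rw [hΦR _ hR, zero_mul]
    · have hT' : ¬ normAbs E (⅟(2 : E) * (x - σ x)) ≤ T := by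
        intro hle
        have : normAbs E x ≤ max R T := by
          rw [hdec]; exact (normAbs_add_le_max _ _).trans (max_le_max (not_lt.1 hR) hle)
        exact absurd hx' (not_lt.2 this)
      rw [Set.indicator_of_notMem (show ⅟(2 : E) * (x - σ x) ∉ {y : E | normAbs E y ≤ T} from hT'), mul_zero]

include hσ hσn in
/-- **`g_T = 0` near `0`**: if `Φ(a) = 0` whenever `‖a‖ ≤ ε`, then `Φ(½(x+σx)) 𝟙[…] = 0` whenever `‖½‖ ‖x‖ ≤ ε` (`‖Re x‖ ≤ ‖½‖‖x‖`, ★ F2). [cite: Tate1950, §2.4] -/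
theorem truncTest_eq_zero_of_normAbs_le (Φ : E → ℂ) {ε : ℝ≥0} (hΦ0 : ∀ a, normAbs E a ≤ ε → Φ a = 0) (T : ℝ≥0) {x : E}
    (hx : normAbs E (⅟(2 : E)) * normAbs E x ≤ ε) :
    Φ (⅟(2 : E) * (x + σ x)) * {y : E | normAbs E y ≤ T}.indicator (fun _ => (1 : ℂ)) (⅟(2 : E) * (x - σ x)) = 0 := by
  have h2 : (⅟(2 : E)) * 2 = 1 := invOf_mul_self _
  have ha : σ (⅟(2 : E) * (x + σ x)) = ⅟(2 : E) * (x + σ x) := by rw [map_mul, map_invOf_two σ, map_add, hσ, add_comm]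
  have hy : σ (⅟(2 : E) * (x - σ x)) = -(⅟(2 : E) * (x - σ x)) := by rw [map_mul, map_invOf_two σ, map_sub, hσ]; ring
  have hdec : ⅟(2 : E) * (x + σ x) + ⅟(2 : E) * (x - σ x) = x := by linear_combination x * h2
  have hle := normAbs_le_half_mul_of_fixed σ hσn ha hy
  rw [hdec] at hle
  rw [hΦ0 _ (le_trans hle hx), zero_mul]

end TruncTest

end Summit.HodgeConjecture.HodgeConjecture.Cruxes.H413.K2E3KeysSkewLineTestFunctions

end
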